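import Summits.HubbardSuperconductivity.HubbardLadder.NeelSignC04AxisUniformRows
import Summits.HubbardSuperconductivity.HubbardLadder.NeelSignUniformShells
import Summits.HubbardSuperconductivity.HubbardLadder.NeelEnergyCeilingGlue
import Summits.HubbardSuperconductivity.HubbardLadder.Bounds.FdcUpper2x2
import Summits.HubbardSuperconductivity.HubbardLadder.HeisenbergPlusAntipodalRowTorus
import Literature.MathematicalPhysics.QuantumLattice.HeisenbergRPSiteMonotonicity
import Literature.MathematicalPhysics.QuantumLattice.HeisenbergMarshallSameSublattice
import Literature.MathematicalPhysics.QuantumLattice.HeisenbergCorrelationGramWindows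
import HarnessLib

/-!
# The Néel cell `(0,4)`, uniformly in the torus side: `c_{2k}(0,4) ≥ 1/40000` for every `k ≥ 20` (HubbardLadder R2, axis-moment certificate A20)

(LEAN FILING #250.2 of 2: the Gram tables and row lemmas `gvA04_q` / `gramA04_q` live in `NeelSignC04AxisUniformRows.lean`, #250.1 — split by the
400-line cap only, lead HOME/INBOX l.2512; heads verbatim as staged in 41d9b1f0b1ebbd40.)

HONEST FRAMING: ladder R1–R4 with certified numbers; no claim on H/H₀; first certified bounds; not a superconductivity
verdict.  Reference model only: the spin-½
Heisenberg antiferromagnet on the even torus `(ℤ/2kℤ)²`; a WEAK, `k`-uniform SIGN statement at a tiny margin — not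
Néel order, nothing about the Hubbard model.

MECHANISM (r2 g32, `pub-hubbard-r2/axis-g32/AXIS-MEMO-g32.md`).  In the Marshall frame on the axis,
`m_s := (-1)^{s+1} c(s+1, 0)`, the rows of the tree valid at SYMBOLIC `k` are: the reflection-positivity Gram form on the
one-rung axis window (`heis_rpGramWindow_range`, DLS Thm 4.2 / KLS eq. (25)) = positivity of the Hankel forms
`Σ_{a,b} g_a g_b m_{a+b}`; the odd-axis antitone row `m_{20} ≤ m_{18}` (`heisRedCorr2_oddAxis_antitone`, Lees–Taggi — it
wraps around the torus); Marshall `m_5 = c(0,6) ≥ 0` (`heisRedCorr2_nonneg_of_even`); the five-site ceiling row CEIL5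
(`PlusAntipodal.heis_ceilingRow_window`); and the energy floor `c(0,1) ≤ -6585041/(6·10⁷)` (`heisRedCorr2_01_le_of_familyUpper` fed BY NAME
with the kernel-certified variational bound `Bounds.heisTL_fdc_upper_2x2`, LEAN FILING #219).  The exact ℚ certificate
`cert04_axis_k20_D0_lean.json` (identity verified coefficientwise by an independent script) reads
`m_3 - 1/40000 = u·CEIL5 + V·ENERGY + w₅ m_5 + κ (m_18 - m_20) + Σ_q Σ_{a,b} h_q[a] h_q[b] m_{a+b} + Σ_n r_n m_n + slack` with
`u, V, w₅, κ ≥ 0`, 11 rational vectors `h_q` (tables `gvA04_q`, sign `(-1)^a` folded in), a rounding residual `|r|₁ ≤ 10⁻⁶` paid by the box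
`|c| ≤ 1/4` (`heisRedCorr2_abs_le`) and `slack > 0`; the final step is `linarith` over the instantiated rows.  Infinite-volume
shadow (EXACT, STRUCTURE.md §1A C11/AX): `1 - T₅(λ) = 16(1-λ)(λ² + λ/2 - 1/4)²` gives `20 m_3 ≥ 5 m_1 - m_0 + 16 m_5` for every
Hausdorff moment sequence.  Consequences: `NeelSignCell 0 4` (`neelSignCell_zero_four`) and, by `neelSignUniformUpTo_four_iff`,
`NeelSignUniformUpTo 4` (the truncation `R = 4` of the typed conjecture (S) `NeelSignUniform`; (S) itself is untouched).  LEAN FILING #250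
(lead GO HOME/INBOX l.2500; certificate `cert04_axis_k20_D0.json` 232c30d7019535ba, Lean twin 57920ff6996841c8).  Everything is proved; no named facts, no numerical input beyond the
rational tables, zero kit. [cite: DLS1978, Theorem 4.2] [cite: KLS1988JSP, eq. (25)] [folklore]
-/

namespace Summit.HubbardSuperconductivity.HubbardLadder

open Finset Literature.MathematicalPhysics.QuantumLattice Literature.Probability.LatticeModels
  Summit.HubbardSuperconductivity.Conjectures

set_option maxHeartbeats 4000000 in
/-- **The cell `(0,4)` uniformly in the side** (certificate A20, TREE ROWS ONLY): `1/40000 ≤ c_{2k}(0,4)` for every `k ≥ 20`.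
HONEST FRAMING: ladder R1–R4 with certified numbers; no claim on H/H₀; first certified bounds; not a superconductivity verdict.
[cite: DLS1978, Theorem 4.2] [cite: KLS1988JSP, eq. (25)] [folklore] -/
theorem heisRedCorr2_C04_floor (k : ℕ) (hk : 20 ≤ k) :
    haveI : NeZero (2 * k) := ⟨by omega⟩
    (1/40000 : ℝ) ≤ heisRedCorr2 (2 * k) 1 0 4 := by
  haveI : NeZero (2 * k) := ⟨by omega⟩
  -- CEIL5: `0 ≤ 5/12 + 4 c(0,1) + c(0,2)`
  have hCE := PlusAntipodal.heis_ceilingRow_window (2 * k) (by omega)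
  -- energy floor, consumed BY NAME: `c(0,1) ≤ (-6585041/10^7)/6`
  have hEN := heisRedCorr2_01_le_of_familyUpper Bounds.heisTL_fdc_upper_2x2 k (by omega)
  push_cast at hEN
  -- Marshall at (0,6)
  have hM : 0 ≤ heisRedCorr2 (2 * k) 1 0 6 := heisRedCorr2_nonneg_of_even (2 * k) (dvd_mul_right 2 k) 1 0 6 (by norm_num)
  -- odd-axis antitone row (Lees–Taggi, wraps around the torus): `-c(21,0) ≤ -c(19,0)`
  have hAT := heisRedCorr2_oddAxis_antitone k 1 (a := 19) (by decide) (by omega) 0 (ε := 1) (Or.inl rfl)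
  rw [heisRedCorr2_swap (2 * k) 1 21 0, heisRedCorr2_swap (2 * k) 1 19 0] at hAT
  norm_num at hAT
  have h_gramA04_0 := gramA04_0 k hk
  have h_gramA04_1 := gramA04_1 k hk
  have h_gramA04_2 := gramA04_2 k hk
  have h_gramA04_3 := gramA04_3 k hk
  have h_gramA04_4 := gramA04_4 k hk
  have h_gramA04_5 := gramA04_5 k hk
  have h_gramA04_6 := gramA04_6 k hk
  have h_gramA04_7 := gramA04_7 k hk
  have h_gramA04_8 := gramA04_8 k hk
  have h_gramA04_9 := gramA04_9 k hk
  have h_gramA04_10 := gramA04_10 k hk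
  have hb_1 : |heisRedCorr2 (2 * k) 1 0 1| ≤ 1 / 4 := by
    have := heisRedCorr2_abs_le (2 * k) 1 0 1
    norm_num at this ⊢
    exact this
  obtain ⟨hl_1, hu_1⟩ := abs_le.mp hb_1
  have hb_2 : |heisRedCorr2 (2 * k) 1 0 2| ≤ 1 / 4 := by
    have := heisRedCorr2_abs_le (2 * k) 1 0 2
    norm_num at this ⊢
    exact this
  obtain ⟨hl_2, hu_2⟩ := abs_le.mp hb_2
  have hb_3 : |heisRedCorr2 (2 * k) 1 0 3| ≤ 1 / 4 := by
    have := heisRedCorr2_abs_le (2 * k) 1 0 3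
    norm_num at this ⊢
    exact this
  obtain ⟨hl_3, hu_3⟩ := abs_le.mp hb_3
  have hb_4 : |heisRedCorr2 (2 * k) 1 0 4| ≤ 1 / 4 := by
    have := heisRedCorr2_abs_le (2 * k) 1 0 4
    norm_num at this ⊢
    exact this
  obtain ⟨hl_4, hu_4⟩ := abs_le.mp hb_4
  have hb_5 : |heisRedCorr2 (2 * k) 1 0 5| ≤ 1 / 4 := by
    have := heisRedCorr2_abs_le (2 * k) 1 0 5
    norm_num at this ⊢
    exact this
  obtain ⟨hl_5, hu_5⟩ := abs_le.mp hb_5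
  have hb_6 : |heisRedCorr2 (2 * k) 1 0 6| ≤ 1 / 4 := by
    have := heisRedCorr2_abs_le (2 * k) 1 0 6
    norm_num at this ⊢
    exact this
  obtain ⟨hl_6, hu_6⟩ := abs_le.mp hb_6
  have hb_7 : |heisRedCorr2 (2 * k) 1 0 7| ≤ 1 / 4 := by
    have := heisRedCorr2_abs_le (2 * k) 1 0 7
    norm_num at this ⊢
    exact this
  obtain ⟨hl_7, hu_7⟩ := abs_le.mp hb_7
  have hb_8 : |heisRedCorr2 (2 * k) 1 0 8| ≤ 1 / 4 := by
    have := heisRedCorr2_abs_le (2 * k) 1 0 8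
    norm_num at this ⊢
    exact this
  obtain ⟨hl_8, hu_8⟩ := abs_le.mp hb_8
  have hb_9 : |heisRedCorr2 (2 * k) 1 0 9| ≤ 1 / 4 := by
    have := heisRedCorr2_abs_le (2 * k) 1 0 9
    norm_num at this ⊢
    exact this
  obtain ⟨hl_9, hu_9⟩ := abs_le.mp hb_9
  have hb_10 : |heisRedCorr2 (2 * k) 1 0 10| ≤ 1 / 4 := by
    have := heisRedCorr2_abs_le (2 * k) 1 0 10
    norm_num at this ⊢
    exact this
  obtain ⟨hl_10, hu_10⟩ := abs_le.mp hb_10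
  have hb_11 : |heisRedCorr2 (2 * k) 1 0 11| ≤ 1 / 4 := by
    have := heisRedCorr2_abs_le (2 * k) 1 0 11
    norm_num at this ⊢
    exact this
  obtain ⟨hl_11, hu_11⟩ := abs_le.mp hb_11
  have hb_12 : |heisRedCorr2 (2 * k) 1 0 12| ≤ 1 / 4 := by
    have := heisRedCorr2_abs_le (2 * k) 1 0 12
    norm_num at this ⊢
    exact this
  obtain ⟨hl_12, hu_12⟩ := abs_le.mp hb_12
  have hb_13 : |heisRedCorr2 (2 * k) 1 0 13| ≤ 1 / 4 := by
    have := heisRedCorr2_abs_le (2 * k) 1 0 13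
    norm_num at this ⊢
    exact this
  obtain ⟨hl_13, hu_13⟩ := abs_le.mp hb_13
  have hb_14 : |heisRedCorr2 (2 * k) 1 0 14| ≤ 1 / 4 := by
    have := heisRedCorr2_abs_le (2 * k) 1 0 14
    norm_num at this ⊢
    exact this
  obtain ⟨hl_14, hu_14⟩ := abs_le.mp hb_14
  have hb_15 : |heisRedCorr2 (2 * k) 1 0 15| ≤ 1 / 4 := by
    have := heisRedCorr2_abs_le (2 * k) 1 0 15
    norm_num at this ⊢
    exact this
  obtain ⟨hl_15, hu_15⟩ := abs_le.mp hb_15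
  have hb_16 : |heisRedCorr2 (2 * k) 1 0 16| ≤ 1 / 4 := by
    have := heisRedCorr2_abs_le (2 * k) 1 0 16
    norm_num at this ⊢
    exact this
  obtain ⟨hl_16, hu_16⟩ := abs_le.mp hb_16
  have hb_17 : |heisRedCorr2 (2 * k) 1 0 17| ≤ 1 / 4 := by
    have := heisRedCorr2_abs_le (2 * k) 1 0 17
    norm_num at this ⊢
    exact this
  obtain ⟨hl_17, hu_17⟩ := abs_le.mp hb_17
  have hb_18 : |heisRedCorr2 (2 * k) 1 0 18| ≤ 1 / 4 := by
    have := heisRedCorr2_abs_le (2 * k) 1 0 18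
    norm_num at this ⊢
    exact this
  obtain ⟨hl_18, hu_18⟩ := abs_le.mp hb_18
  have hb_19 : |heisRedCorr2 (2 * k) 1 0 19| ≤ 1 / 4 := by
    have := heisRedCorr2_abs_le (2 * k) 1 0 19
    norm_num at this ⊢
    exact this
  obtain ⟨hl_19, hu_19⟩ := abs_le.mp hb_19
  have hb_20 : |heisRedCorr2 (2 * k) 1 0 20| ≤ 1 / 4 := by
    have := heisRedCorr2_abs_le (2 * k) 1 0 20
    norm_num at this ⊢
    exact this
  obtain ⟨hl_20, hu_20⟩ := abs_le.mp hb_20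
  have hb_21 : |heisRedCorr2 (2 * k) 1 0 21| ≤ 1 / 4 := by
    have := heisRedCorr2_abs_le (2 * k) 1 0 21
    norm_num at this ⊢
    exact this
  obtain ⟨hl_21, hu_21⟩ := abs_le.mp hb_21
  linarith

/-- `(0,4)`: the cell of the typed conjecture (S), `q = 1/40000`, `k₀ = 20` (LEAN FILING #250, lead GO HOME/INBOX l.2500).
HONEST FRAMING: ladder R1–R4 with certified numbers; no claim on H/H₀; first certified bounds; not a superconductivity verdict. -/
theorem neelSignCell_zero_four : NeelSignCell 0 4 :=
  ⟨1 / 40000, by norm_num, 20, neelSign_row_of_floor (a := 0) (b := 4) (by decide) (1 / 40000) 20 fun k hk => by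
    have h := heisRedCorr2_C04_floor k hk
    push_cast
    linarith⟩

/-- `(0,4)` under the numeral naming of `NeelSignUniformShells` (`neelSignCell_0_1`, `_0_3`, `_0_5`, …). -/
theorem neelSignCell_0_4 : NeelSignCell 0 4 := neelSignCell_zero_four

/-- The truncation `R = 4` of the typed conjecture (S): `NeelSignUniformUpTo 4` — every cell `a ≤ b`, `a + b ≤ 4` except
`(0,4)` was of record (`neelSignUniformUpTo_four_iff`); `(0,4)` is `neelSignCell_zero_four`.  (S) itself is untouched.
HONEST FRAMING: ladder R1–R4 with certified numbers; no claim on H/H₀; first certified bounds; not a superconductivity verdict. -/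
theorem neelSignUniformUpTo_four : NeelSignUniformUpTo 4 :=
  neelSignUniformUpTo_four_iff.mpr neelSignCell_zero_four

end Summit.HubbardSuperconductivity.HubbardLadder
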